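import Summits.AtomisticToContinuum.Crystallization.Theorems.ExcessDecayLiouvilleSiteGeometry

/-!
# Route `ExcessDecayLiouville`: lattice directions and the one-dimensional discrete Sobolev inequality

Two elementary ingredients of step (c3) (`LatticeSobolev`) of the energy route for item `ExcessDecay`
(stmt-AtomisticToContinuum-9334):

* the in-plane generators `u₁, u₂ ∈ Λ₀` are unit vectors, so `‖A u_i‖ ≤ 199/200 ≤ 11/10` for admissible `A`
  (`triangularVec₂_mem_Λ₀`, `norm_apply_triangularVec_le`): the nearest-neighbour translation
  differences along `u₁, u₂` are admissible directions for `gradient_estimate(_local)`;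
* the **1-D discrete Sobolev / mean-value inequality** in a normed group: for `g : ℕ → F` and `x ≤ n`,
  `‖g x‖ ≤ (Σ_{i ≤ n} ‖g i‖)/(n+1) + Σ_{i < n} ‖g (i+1) − g i‖` (`norm_le_avg_add_sum_diff`), and its Cauchy–Schwarz
  form `‖g x‖² ≤ 2 (Σ_{i ≤ n} ‖g i‖²)/(n+1) + 2 n Σ_{i<n} ‖g(i+1) − g i‖²` (`norm_sq_le_of_sum_sq`).

All `[folklore]`; helper lemmas, nothing here closes an item.
-/

noncomputable section

namespace Summit.AtomisticToContinuum.Crystallization.Theorems.ExcessDecayLiouville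

open scoped BigOperators Topology InnerProductSpace RealInnerProductSpace Classical
open Literature.MathematicalPhysics.StatisticalMechanics
open Summit.AtomisticToContinuum.Crystallization.Theorems.PhononStabilityNegative

/-! ## In-plane lattice directions -/

/-- `u₂ ∈ Λ₀`. [folklore] -/
theorem triangularVec₂_mem_Λ₀ : triangularVec₂ 1 ∈ Λ₀ :=
  ⟨0, 1, 0, by simp⟩

/-- `‖A u₁‖ ≤ 11/10` and `‖A u₂‖ ≤ 11/10` for admissible `A` (`u₁, u₂` are unit vectors). [folklore] -/
theorem norm_apply_triangularVec_le {A : (EuclideanSpace ℝ (Fin 3)) →L[ℝ] (EuclideanSpace ℝ (Fin 3))} (hA : Adm₀ A) :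
    ‖A (triangularVec₁ 1)‖ ≤ 11 / 10 ∧ ‖A (triangularVec₂ 1)‖ ≤ 11 / 10 := by
  have hn2 : ‖(triangularVec₂ 1 : (EuclideanSpace ℝ (Fin 3)))‖ = 1 := by
    have h := hcpLiouvilleLam_norm_sq 0 1 0
    simp only [Int.cast_one, one_smul, Int.cast_zero, zero_smul, zero_add, add_zero] at h
    have hn : 0 ≤ ‖(triangularVec₂ 1 : (EuclideanSpace ℝ (Fin 3)))‖ := norm_nonneg _
    nlinarith [h, hn]
  constructor
  · have := norm_apply_le_of_adm₀ hA (triangularVec₁ 1)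
    rw [norm_triangularVec₁, mul_one] at this
    linarith
  · have := norm_apply_le_of_adm₀ hA (triangularVec₂ 1)
    rw [hn2, mul_one] at this
    linarith

/-! ## The one-dimensional discrete Sobolev inequality -/

section OneD

variable {F : Type*} [SeminormedAddCommGroup F]

/-- Telescoping bound: `‖g x − g y‖ ≤ Σ_{i<n} ‖g(i+1) − g i‖` for `x, y ≤ n`. [folklore] -/
theorem norm_sub_le_sum_diff (g : ℕ → F) {n x y : ℕ} (hx : x ≤ n) (hy : y ≤ n) :
    ‖g x - g y‖ ≤ ∑ i ∈ Finset.range n, ‖g (i + 1) - g i‖ := by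
  -- wlog y ≤ x by symmetry of the norm of a difference
  have key : ∀ a b : ℕ, a ≤ b → b ≤ n → ‖g b - g a‖ ≤ ∑ i ∈ Finset.range n, ‖g (i + 1) - g i‖ := by
    intro a b hab hbn
    have htel : g b - g a = ∑ i ∈ Finset.Ico a b, (g (i + 1) - g i) := by
      rw [Finset.sum_Ico_eq_sum_range]
      induction b, hab using Nat.le_induction with
      | base => simp
      | succ k hk ih =>
        rw [Nat.succ_sub hk, Finset.sum_range_succ, ← ih (by omega)]
        have : a + (k - a) = k := by omega
        rw [this]; abel
    rw [htel]
    refine (norm_sum_le _ _).trans ?_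
    refine Finset.sum_le_sum_of_subset_of_nonneg ?_ (fun i _ _ => norm_nonneg _)
    intro i hi
    simp only [Finset.mem_Ico] at hi
    simp only [Finset.mem_range]
    omega
  rcases le_total y x with h | h
  · exact key y x h hx
  · rw [← norm_neg, neg_sub]
    exact key x y h hy

/-- **1-D discrete Sobolev inequality**: `‖g x‖ ≤ (Σ_{i≤n} ‖g i‖)/(n+1) + Σ_{i<n} ‖g(i+1) − g i‖` for `x ≤ n`.
[folklore] -/
theorem norm_le_avg_add_sum_diff (g : ℕ → F) {n x : ℕ} (hx : x ≤ n) :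
    ‖g x‖ ≤ (∑ i ∈ Finset.range (n + 1), ‖g i‖) / (n + 1) + ∑ i ∈ Finset.range n, ‖g (i + 1) - g i‖ := by
  have hpt : ∀ y ∈ Finset.range (n + 1), ‖g x‖ ≤ ‖g y‖ + ∑ i ∈ Finset.range n, ‖g (i + 1) - g i‖ := by
    intro y hy
    have hy' : y ≤ n := by simpa [Finset.mem_range, Nat.lt_succ_iff] using hy
    have := norm_sub_le_sum_diff g hx hy'
    have h2 : ‖g x‖ ≤ ‖g y‖ + ‖g x - g y‖ := by
      have := norm_add_le (g y) (g x - g y)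
      rwa [add_sub_cancel] at this
    linarith
  have hsum := Finset.sum_le_sum hpt
  simp only [Finset.sum_const, Finset.card_range, nsmul_eq_mul, Finset.sum_add_distrib] at hsum
  have hn : (0 : ℝ) < n + 1 := by positivity
  rw [div_add' _ _ _ hn.ne', le_div_iff₀ hn]
  push_cast at hsum ⊢
  linarith

/-- **1-D discrete Sobolev inequality, squared form**:
`‖g x‖² ≤ 2 (Σ_{i≤n} ‖g i‖²)/(n+1) + 2 n Σ_{i<n} ‖g(i+1) − g i‖²` for `x ≤ n` (Cauchy–Schwarz). [folklore] -/
theorem norm_sq_le_of_sum_sq (g : ℕ → F) {n x : ℕ} (hx : x ≤ n) :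
    ‖g x‖ ^ 2 ≤ 2 * (∑ i ∈ Finset.range (n + 1), ‖g i‖ ^ 2) / (n + 1) +
      2 * n * ∑ i ∈ Finset.range n, ‖g (i + 1) - g i‖ ^ 2 := by
  have h := norm_le_avg_add_sum_diff g hx
  have hn : (0 : ℝ) < n + 1 := by positivity
  -- Cauchy–Schwarz for both sums: (Σ a_i)² ≤ #· Σ a_i²
  have cs1 : (∑ i ∈ Finset.range (n + 1), ‖g i‖) ^ 2 ≤ (n + 1) * ∑ i ∈ Finset.range (n + 1), ‖g i‖ ^ 2 := by
    have := sq_sum_le_card_mul_sum_sq (s := Finset.range (n + 1)) (f := fun i => ‖g i‖)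
    simpa [Finset.card_range] using this
  have cs2 : (∑ i ∈ Finset.range n, ‖g (i + 1) - g i‖) ^ 2 ≤ n * ∑ i ∈ Finset.range n, ‖g (i + 1) - g i‖ ^ 2 := by
    have := sq_sum_le_card_mul_sum_sq (s := Finset.range n) (f := fun i => ‖g (i + 1) - g i‖)
    simpa [Finset.card_range] using this
  set S₁ := ∑ i ∈ Finset.range (n + 1), ‖g i‖ with hS₁
  set S₂ := ∑ i ∈ Finset.range n, ‖g (i + 1) - g i‖ with hS₂
  set Q₁ := ∑ i ∈ Finset.range (n + 1), ‖g i‖ ^ 2 with hQ₁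
  set Q₂ := ∑ i ∈ Finset.range n, ‖g (i + 1) - g i‖ ^ 2 with hQ₂
  have h0 : 0 ≤ ‖g x‖ := norm_nonneg _
  have hS1 : 0 ≤ S₁ := Finset.sum_nonneg fun i _ => norm_nonneg _
  have hS2 : 0 ≤ S₂ := Finset.sum_nonneg fun i _ => norm_nonneg _
  -- ‖g x‖² ≤ (S₁/(n+1) + S₂)² ≤ 2 S₁²/(n+1)² + 2 S₂² ≤ 2 Q₁/(n+1) + 2 n Q₂
  have h1 : ‖g x‖ ^ 2 ≤ (S₁ / (n + 1) + S₂) ^ 2 := pow_le_pow_left₀ h0 h 2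
  have h2 : (S₁ / (n + 1) + S₂) ^ 2 ≤ 2 * (S₁ / (n + 1)) ^ 2 + 2 * S₂ ^ 2 := by
    nlinarith [sq_nonneg (S₁ / (n + 1) - S₂)]
  have h3 : (S₁ / (n + 1)) ^ 2 ≤ Q₁ / (n + 1) := by
    rw [div_pow, div_le_div_iff₀ (by positivity) hn]
    nlinarith [cs1]
  have h4 : S₂ ^ 2 ≤ n * Q₂ := cs2
  have : 2 * Q₁ / (↑n + 1) = 2 * (Q₁ / (n + 1)) := by ring
  rw [this]
  nlinarith [h1, h2, h3, h4]

end OneD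

end Summit.AtomisticToContinuum.Crystallization.Theorems.ExcessDecayLiouville

end
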